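import Mathlib
import Summits.ValiantsHypothesis.ValiantsHypothesis.Theorems.NewtonUnitEquationsTwoProductsFormalLogLinearisationDefs
import Summits.ValiantsHypothesis.ValiantsHypothesis.Theorems.NewtonUnitEquationsTwoProductsPlanarCrossCount
import Summits.ValiantsHypothesis.ValiantsHypothesis.Theorems.TwoProducts.Negative.RowCoincidenceThreeDigitBox
import Summits.ValiantsHypothesis.ValiantsHypothesis.Theorems.TwoProducts.Negative.RowRigiditySquareDifference
import HarnessLib

/-!
# A fifth exception to box row-coincidence: non-unique sparse factorisation on the diagonal (`m = 2`), and the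
  failure of top-letter trace conservation

Negative lane, `--supports stmt-ValiantsHypothesis-5906` (route `NewtonUnitEquations`, crux `TwoProducts`, line
`relation_ladder`; ideas `subbox-congruence-cascade`, `first-variation-resolvent`). No summit statement is proved here.
Record «DIAG-3» of the val-neg-1 g8 census (memo EXCEPTIONS-33, 474b62ccc22331fa), exact.

With `Z := X^(1,1)` and the digit letters `Z, Z², Z⁴ = T` (grid `A_4`):

  `1 + u = (1 − Z − Z² + 2Z⁴, 1 + Z − Z² + 2Z⁴)`,  `1 + v = (1 − 2Z² + 2Z⁴, 1 − Z² + Z⁴)`,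
  `∏(1+u) = (1 − Z² + 2Z⁴)² − Z² = 1 − 3Z² + 5Z⁴ − 4Z⁶ + 4Z⁸`,  `∏(1+v) = 1 − 3Z² + 5Z⁴ − 4Z⁶ + 2Z⁸`,
  so `D = ∏(1+u) − ∏(1+v) = 2Z⁸ = 2·X^(8,8) = 2·X^(2T)`.

`p = (8,8) = 2T` is LL-visible, the rows truncated to `[0,8)²` are the rows and differ as multisets, and the TOTAL
`T`-COEFFICIENT differs between the two sides: `2 + 2 = 4` on `u` versus `2 + 1 = 3` on `v`. Hence the «top-letter trace
law» — at an exceptional LL-visible corner `p = 2t` the sums `Σ_j coeff_t(u_j)` and `Σ_j coeff_t(v_j)` agree — which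
holds on the other recorded mechanisms (E_T: `3 − 1 = 1 + 1`; SQ: `0 = −1 + 1`; SV: `0 = 1 − 1 + i − i`; E_B: `t` absent),
is FALSE already at `m = 2`: `T = Z⁴` is a sum of smaller letters, so the `X^T`-coefficient of `D` is not the trace
difference. [folklore]
-/

set_option linter.dupNamespace false

open scoped BigOperators
open MvPolynomial
open Summit.ValiantsHypothesis.ValiantsHypothesis.Theorems.NewtonUnitEquations.TwoProducts.FormalLogLinearisation
open Summit.ValiantsHypothesis.ValiantsHypothesis.Theorems.NewtonUnitEquations.TwoProducts.PlanarCell (tailSupport)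
open Summit.ValiantsHypothesis.ValiantsHypothesis.Theorems.NewtonUnitEquations.TwoProducts.Negative.RowCoincidence
open Summit.ValiantsHypothesis.ValiantsHypothesis.Theorems.NewtonUnitEquations.TwoProducts.Negative.SquareDifference

namespace Summit.ValiantsHypothesis.ValiantsHypothesis.Theorems.NewtonUnitEquations.TwoProducts.Negative.DiagonalFactorisation

noncomputable section

/-- f-tails `u = (−Z − Z² + 2T, Z − Z² + 2T)`. -/
def gu : Fin 2 → MvPolynomial (Fin 2) ℂ := ![row3 (-1) (-1) 2, row3 1 (-1) 2]

/-- g-tails `v = (−2Z² + 2T, −Z² + T)`. -/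
def gv : Fin 2 → MvPolynomial (Fin 2) ℂ := ![row3 0 (-2) 2, row3 0 (-1) 1]

/-- The tail difference is `2·X^(8,8)`: two distinct sparse factorisations of the same 6-jet on the diagonal. -/
theorem tailDiff_eq : tailDiff gu gv = monomial pp 2 := by
  have hpp : pp = Finsupp.single 0 8 + Finsupp.single 1 8 := by
    ext i; fin_cases i <;> simp [pp, et]
  have h8 : (monomial pp (2 : ℂ) : MvPolynomial (Fin 2) ℂ) = C 2 * X 0 ^ 8 * X 1 ^ 8 := by
    rw [C_mul_X_eq, hpp]
  simp only [tailDiff, gu, gv, Fin.prod_univ_two, Matrix.cons_val_zero, Matrix.cons_val_one]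
  rw [h8, row3_eq, row3_eq, row3_eq, row3_eq]
  simp only [map_neg, map_one, map_zero, map_ofNat]
  ring

/-- Coefficients of the tail difference. -/
theorem coeff_tailDiff (x : Expo) : coeff x (tailDiff gu gv) = if pp = x then (2 : ℂ) else 0 := by
  rw [tailDiff_eq, coeff_monomial]

/-- The support of the tail difference is `{2T}`. -/
theorem mem_support_tailDiff {x : Expo} (hx : x ∈ (tailDiff gu gv).support) : x = pp := by
  rw [mem_support_iff, coeff_tailDiff] at hx
  by_contra h
  exact hx (by simp [Ne.symm h])

/-- `2T` is in the support. -/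
theorem pp_mem_support : pp ∈ (tailDiff gu gv).support := by
  rw [mem_support_iff, coeff_tailDiff]; simp

/-- `ξ = (−1,−1)` is a valid weight for the instance. -/
theorem validWeight_xi : ValidWeight gu gv xi := by
  refine ⟨fun j e he => ?_, fun j e he => ?_⟩ <;> fin_cases j <;> exact wt_row3_neg (by simpa [gu, gv] using he)

/-- `2T` is the strict `ξ`-top of the (singleton) tail support. -/
theorem isStrictTop_pp : IsStrictTop xi (↑(tailDiff gu gv).support : Set Expo) pp := by
  refine ⟨by exact_mod_cast pp_mem_support, fun μ hμ hne => ?_⟩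
  exact absurd (mem_support_tailDiff (by exact_mod_cast hμ)) hne

/-- `p = (8,8)` is LL-visible. -/
theorem pp_mem_llVisible : pp ∈ llVisible gu gv :=
  ⟨xi, by simp, by simp, validWeight_xi, isStrictTop_pp⟩

/-- Truncated `u`-rows = the `u`-rows. -/
theorem boxTrunc_gu : (fun j => boxTrunc 8 8 (gu j)) = gu := by
  funext j; fin_cases j <;> simp [gu, boxTrunc_row3]

/-- Truncated `v`-rows = the `v`-rows. -/
theorem boxTrunc_gv : (fun j => boxTrunc 8 8 (gv j)) = gv := by
  funext j; fin_cases j <;> simp [gv, boxTrunc_row3]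

/-- `u₁` is not a `v`-row (its `Z`-coefficient is `−1`, theirs are `0`). -/
theorem gu0_notMem : ∀ j, gv j ≠ gu 0 := by
  intro j hj
  have hc := congrArg (coeff zz) hj
  fin_cases j <;> simp [gu, gv] at hc

/-- The truncated rows of the two sides are NOT equal as multisets (box-coincidence fails at `p`). -/
theorem truncated_rows_ne :
    (Finset.univ.val.map fun j => boxTrunc 8 8 (gu j)) ≠ (Finset.univ.val.map fun j => boxTrunc 8 8 (gv j)) := by
  rw [boxTrunc_gu, boxTrunc_gv]
  intro h
  have hmem : gu 0 ∈ (Finset.univ.val.map gv) := by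
    rw [← h]; exact Multiset.mem_map.2 ⟨0, Finset.mem_univ_val 0, rfl⟩
  obtain ⟨j, -, hj⟩ := Multiset.mem_map.1 hmem
  exact gu0_notMem j hj

/-- The `T`-trace of the `u`-side is `4`. -/
theorem trace_gu : ∑ j, coeff et (gu j) = 4 := by
  simp [gu, Fin.sum_univ_two]; norm_num

/-- The `T`-trace of the `v`-side is `3`. -/
theorem trace_gv : ∑ j, coeff et (gv j) = 3 := by
  simp [gv, Fin.sum_univ_two]; norm_num

/-- The `T`-traces differ. -/
theorem trace_ne : ∑ j, coeff et (gu j) ≠ ∑ j, coeff et (gv j) := by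
  rw [trace_gu, trace_gv]; norm_num

/-- The top letter `T = (4,4)` IS a tail letter of the instance (coefficient `2` in `u₁`). -/
theorem et_mem_tailSupport : et ∈ tailSupport gu gv := by
  unfold tailSupport
  refine Finset.mem_union.2 (Or.inl (Finset.mem_biUnion.2 ⟨0, Finset.mem_univ 0, ?_⟩))
  rw [mem_support_iff]; simp [gu]

/-- `u`-rows are digit-grid rows. -/
theorem gu_digitGrid : ∀ j, ∀ e ∈ (gu j).support, e ∈ DigitGrid 4 := by
  intro j; fin_cases j <;> exact row3_support_digitGrid
/-- `v`-rows are digit-grid rows. -/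
theorem gv_digitGrid : ∀ j, ∀ e ∈ (gv j).support, e ∈ DigitGrid 4 := by
  intro j; fin_cases j <;> exact row3_support_digitGrid

/-- **The DIAG-3 witness, packaged** (`m = 2`, `s = 4`): digit-grid rows, `D = 2X^(2T)`, `p = 2T` LL-visible, box-coincidence
below `p` fails, `T` is a tail letter, and the `T`-traces of the two sides differ (`4 ≠ 3`). -/
theorem diagonalFactorisation_witness :
    (∀ j, ∀ e ∈ (gu j).support, e ∈ DigitGrid 4) ∧ (∀ j, ∀ e ∈ (gv j).support, e ∈ DigitGrid 4) ∧
    tailDiff gu gv = monomial pp 2 ∧ pp ∈ llVisible gu gv ∧ pp = et + et ∧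
    (Finset.univ.val.map fun j => boxTrunc (pp 0) (pp 1) (gu j)) ≠
      (Finset.univ.val.map fun j => boxTrunc (pp 0) (pp 1) (gv j)) ∧
    et ∈ tailSupport gu gv ∧ ∑ j, coeff et (gu j) ≠ ∑ j, coeff et (gv j) := by
  refine ⟨gu_digitGrid, gv_digitGrid, tailDiff_eq, pp_mem_llVisible, rfl, ?_, et_mem_tailSupport, trace_ne⟩
  rw [show pp 0 = 8 by simp [pp, et], show pp 1 = 8 by simp [pp, et]]; exact truncated_rows_ne

/-- **The top-letter trace law is false** (`m = 2`): there are digit-grid instances with an exceptional LL-visible corner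
`p = 2t`, `t` a tail letter, at which the total `t`-coefficients of the two sides differ. -/
theorem not_topLetterTrace_of_exceptional_corner :
    ¬ (∀ (m s : ℕ) (u v : Fin m → MvPolynomial (Fin 2) ℂ),
        (∀ j, ∀ e ∈ (u j).support, e ∈ DigitGrid s) → (∀ j, ∀ e ∈ (v j).support, e ∈ DigitGrid s) →
        ∀ p ∈ llVisible u v, ∀ t ∈ tailSupport u v, p = t + t →
          (Finset.univ.val.map fun j => boxTrunc (p 0) (p 1) (u j)) ≠
            (Finset.univ.val.map fun j => boxTrunc (p 0) (p 1) (v j)) →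
          ∑ j, coeff t (u j) = ∑ j, coeff t (v j)) := by
  intro H
  obtain ⟨hu, hv, -, hvis, hpp, hne, ht, htr⟩ := diagonalFactorisation_witness
  exact htr (H 2 4 gu gv hu hv pp hvis et ht hpp hne)

end

end Summit.ValiantsHypothesis.ValiantsHypothesis.Theorems.NewtonUnitEquations.TwoProducts.Negative.DiagonalFactorisation
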